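import Literature.NumberTheory.Sieve.FordMaynardFragmentationBackwardPrep
import HarnessLib

/-!
# Ford–Maynard, Theorem 6.4: the fragmentation relation implies (TypeI-f)

Everything here is PROVED. Ninth file towards Theorem 6.4 of K. Ford, J. Maynard,
*On the theory of prime producing sieves* (arXiv:2407.14368): the implication (6.3) ⇒ (TypeI-f)
(`typeI_of_fragRel`), following §6.1 (last paragraph). For `ξ ∈ ℝ^r` with `|ξ| ≤ γ` and
`w = 1 − |ξ| ≥ 1 − γ`, the `d`-th term of (TypeI-f) is `(1/d!) ∫_{u ∈ Δ_d(w)} f(ξ,u)/∏u`; by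
symmetry `f(ξ,u) = f(u,ξ)`, and the fragmentation relation at `(u, ξ)` (in the iterated form
`fragOp_eq_multiSlice`, split into the `u`-blocks and the `ξ`-blocks by `fragH_split`) expresses
it through the functions

  `Ψ_{k'}(β) = 𝟙[β ≥ η]/∏β · ∫_{ξ-blocks β'} 𝟙[β' ≥ η] ∏ w(β'_j) f(β, β')`   (`A(u)` of §6.1),

symmetric, bounded and measurable (`psiFn_symm`, `abs_psiFn_le`, `measurable_psiFn`). After the
multi-block Fubini formula `sliceIntegral_multiSlice` the `u`-side becomes
`∑_{h} ∫_{Δ_{|h|}(w)} ∏_j 𝓛_{1−γ}(β_j)/h_j! Ψ(β) dβ`, which the symmetrisation `claim` turns into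
`(1/a!) ∫_{Δ_a(w)} 𝓛^{⋆d} Ψ`; summing `(1/d!)·` over `d`, Lemma 5.4 (`FordMaynard_lemma_5_4`,
`∑_d 𝓛^{⋆d}/d! = 0` on vectors of total `≥ 1 − γ`) gives zero.

## References

* K. Ford, J. Maynard, *On the theory of prime producing sieves*, arXiv:2407.14368 (2024), §6.1
  (proof of Theorem 6.4, "Now we deduce (TypeI-f) from (6.3)"), Lemma 5.4.
  [FordMaynard2024PrimeSieves]
-/

noncomputable section

open MeasureTheory Finset Literature.Combinatorics.Enumerative

namespace Literature.NumberTheory.Sieve.FordMaynard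

section Backward

variable {η γ : ℝ} {f : VecFn}

/-! ### Functions supported on vectors with entries `≥ η` vanish in large dimension -/

/-- If `f` is supported on vectors with entries `≥ η > 0` summing to `1`, then `f ≡ 0` in every
dimension `k > ⌊1/η⌋`. [cite: FordMaynard2024PrimeSieves, §6 (remark after Definition 6.2)] -/
theorem eq_zero_of_maxBlock_lt (hη : 0 < η)
    (hsupp : ∀ (k : ℕ) (ξ : Fin k → ℝ), f k ξ ≠ 0 → (∀ i, η ≤ ξ i) ∧ ∑ i, ξ i = 1)
    {k : ℕ} (hk : maxBlock η < k) (ξ : Fin k → ℝ) : f k ξ = 0 := by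
  by_contra h
  obtain ⟨hge, hsum⟩ := hsupp k ξ h
  have hle : (k : ℝ) * η ≤ 1 := by
    calc (k : ℝ) * η = ∑ _i : Fin k, η := by simp
      _ ≤ ∑ i, ξ i := Finset.sum_le_sum fun i _ => hge i
      _ = 1 := hsum
  have hk' : (k : ℝ) ≤ 1 / η := by rw [le_div_iff₀ hη]; exact hle
  have : k ≤ maxBlock η := Nat.le_floor hk'
  omega

/-! ### The functions `Ψ` obtained by integrating out the `ξ`-blocks -/

/-- The weight of the `ξ`-blocks is bounded on vectors with entries `≥ η`. [folklore] -/
theorem abs_prod_blockWeight_le (hη : 0 < η) (γ : ℝ) {r : ℕ} (k : Fin r → ℕ)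
    (β' : Fin (bsum r k) → ℝ) (hβ' : ∀ t, η ≤ β' t) :
    |∏ j, blockWeight γ (k j) (fun l => β' (Fin.cast (bsum_eq_sum r k).symm (finSigmaFinEquiv (n := k) ⟨j, l⟩)))| ≤
      ∏ j, ((k j : ℝ) * (2 ^ k j) ^ k j / η ^ k j) := by
  rw [Finset.abs_prod]
  exact Finset.prod_le_prod (fun j _ => abs_nonneg _) fun j _ => abs_blockWeight_le hη (k j) _ fun l => hβ' _

/-- Measurability of the weight of the `ξ`-blocks. [folklore] -/
theorem measurable_prod_blockWeight (γ : ℝ) {r : ℕ} (k : Fin r → ℕ) :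
    Measurable fun β' : Fin (bsum r k) → ℝ =>
      ∏ j, blockWeight γ (k j) (fun l => β' (Fin.cast (bsum_eq_sum r k).symm (finSigmaFinEquiv (n := k) ⟨j, l⟩))) :=
  Finset.measurable_prod _ fun j _ => (measurable_blockWeight γ (k j)).comp
    (measurable_pi_iff.2 fun _ => measurable_pi_apply _)

/-- **Symmetry of `Ψ`.** [cite: FordMaynard2024PrimeSieves, §6.1 ("The function ... is symmetric in β₁,…,β_m")] -/
theorem psiFn_symm (hs : f.IsSymmetric) (γ η : ℝ) {r : ℕ} (k : Fin r → ℕ) (ξ : Fin r → ℝ) :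
    VecFn.IsSymmetric (fun n β => if ∀ t, η ≤ β t then
      multiSlice r k ξ (fun β' => if ∀ t, η ≤ β' t then
        (∏ j, blockWeight γ (k j) (fun l =>
            β' (Fin.cast (bsum_eq_sum r k).symm (finSigmaFinEquiv (n := k) ⟨j, l⟩)))) *
          f (n + bsum r k) (Fin.append β β') else 0) / ∏ t, β t else 0) := by
  intro n σ β
  have hcond : (∀ t, η ≤ (β ∘ σ) t) ↔ ∀ t, η ≤ β t :=
    ⟨fun h t => by simpa using h (σ.symm t), fun h t => h (σ t)⟩
  have hprod : ∏ t, (β ∘ σ) t = ∏ t, β t := Equiv.prod_comp σ β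
  dsimp only
  rw [hprod]
  simp only [hcond]
  congr 1
  congr 1
  refine multiSlice_congr r k ξ fun β' => ?_
  rw [hs.append_perm_left]

/-- **Measurability of `Ψ`.** [folklore] -/
theorem measurable_psiFn (hfm : ∀ k, Measurable (f k)) (γ η : ℝ) {r : ℕ} (k : Fin r → ℕ)
    (ξ : Fin r → ℝ) (n : ℕ) :
    Measurable fun β : Fin n → ℝ => if ∀ t, η ≤ β t then
      multiSlice r k ξ (fun β' => if ∀ t, η ≤ β' t then
        (∏ j, blockWeight γ (k j) (fun l =>
            β' (Fin.cast (bsum_eq_sum r k).symm (finSigmaFinEquiv (n := k) ⟨j, l⟩)))) *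
          f (n + bsum r k) (Fin.append β β') else 0) / ∏ t, β t else 0 := by
  refine Measurable.ite ?_ ?_ measurable_const
  · exact (Measurable.forall fun t => measurableSet_setOf.1
      (measurableSet_le measurable_const (measurable_pi_apply t))).setOf
  refine Measurable.div ?_ (Finset.measurable_prod _ fun t _ => measurable_pi_apply t)
  refine measurable_multiSlice_param (X := Fin n → ℝ) r k (ψ := fun _ => ξ) measurable_const ?_
  refine Measurable.ite ?_ ?_ measurable_const
  · refine (Measurable.forall fun t => ?_).setOf
    have hm : Measurable fun q : (Fin n → ℝ) × (Fin (bsum r k) → ℝ) => q.2 t :=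
      (measurable_pi_apply t).comp measurable_snd
    exact measurableSet_setOf.1 (measurableSet_le measurable_const hm)
  · exact ((measurable_prod_blockWeight γ k).comp measurable_snd).mul ((hfm _).comp measurable_finAppend)

/-- A bound for the inner iterated integral of `Ψ`. [folklore] -/
theorem abs_psiInner_le (hη : 0 < η) (γ : ℝ) {Fb : ℝ} (hFb : ∀ k ξ, |f k ξ| ≤ Fb) {r : ℕ}
    (k : Fin r → ℕ) (ξ : Fin r → ℝ) (n : ℕ) (β : Fin n → ℝ) :
    |multiSlice r k ξ (fun β' => if ∀ t, η ≤ β' t then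
        (∏ j, blockWeight γ (k j) (fun l =>
            β' (Fin.cast (bsum_eq_sum r k).symm (finSigmaFinEquiv (n := k) ⟨j, l⟩)))) *
          f (n + bsum r k) (Fin.append β β') else 0)| ≤
      (∏ j, ((k j : ℝ) * (2 ^ k j) ^ k j / η ^ k j)) * Fb * (1 + ∑ j, |ξ j|) ^ bsum r k := by
  have hFb0 : 0 ≤ Fb := (abs_nonneg _).trans (hFb 0 Fin.elim0)
  refine abs_multiSlice_le r k (R := 1 + ∑ j, |ξ j|)
    (by have := Finset.sum_nonneg (fun j (_ : j ∈ (univ : Finset (Fin r))) => abs_nonneg (ξ j)); linarith)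
    (fun j => ?_) (by positivity) (fun β' => ?_)
  · have : |ξ j| ≤ ∑ j', |ξ j'| := Finset.single_le_sum (fun j' _ => abs_nonneg (ξ j')) (Finset.mem_univ j)
    linarith [le_abs_self (ξ j)]
  · split_ifs with hβ'
    · rw [abs_mul]
      exact mul_le_mul (abs_prod_blockWeight_le hη γ k β' hβ') (hFb _ _) (abs_nonneg _)
        (Finset.prod_nonneg fun j _ => by positivity)
    · rw [abs_zero]
      exact mul_nonneg (Finset.prod_nonneg fun j _ => by positivity) hFb0

/-- **A uniform bound for `Ψ`** (uniform in the dimension: `Ψ_n ≡ 0` for `n > ⌊1/η⌋`, `f` being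
supported in dimension `≤ 1/η`). [folklore] -/
theorem abs_psiFn_le (hη : 0 < η) (hη1 : η ≤ 1) (γ : ℝ) {Fb : ℝ} (hFb : ∀ k ξ, |f k ξ| ≤ Fb)
    (hsupp : ∀ (k : ℕ) (ξ : Fin k → ℝ), f k ξ ≠ 0 → (∀ i, η ≤ ξ i) ∧ ∑ i, ξ i = 1)
    {r : ℕ} (k : Fin r → ℕ) (ξ : Fin r → ℝ) (n : ℕ) (β : Fin n → ℝ) :
    |(if ∀ t, η ≤ β t then
      multiSlice r k ξ (fun β' => if ∀ t, η ≤ β' t then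
        (∏ j, blockWeight γ (k j) (fun l =>
            β' (Fin.cast (bsum_eq_sum r k).symm (finSigmaFinEquiv (n := k) ⟨j, l⟩)))) *
          f (n + bsum r k) (Fin.append β β') else 0) / ∏ t, β t else 0)| ≤
      (∏ j, ((k j : ℝ) * (2 ^ k j) ^ k j / η ^ k j)) * Fb * (1 + ∑ j, |ξ j|) ^ bsum r k / η ^ maxBlock η := by
  have hFb0 : 0 ≤ Fb := (abs_nonneg _).trans (hFb 0 Fin.elim0)
  have hC0 : 0 ≤ (∏ j, ((k j : ℝ) * (2 ^ k j) ^ k j / η ^ k j)) * Fb * (1 + ∑ j, |ξ j|) ^ bsum r k := by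
    have : 0 ≤ ∑ j, |ξ j| := Finset.sum_nonneg fun j _ => abs_nonneg _
    exact mul_nonneg (mul_nonneg (Finset.prod_nonneg fun j _ => by positivity) hFb0) (by positivity)
  split_ifs with hβ
  swap
  · rw [abs_zero]; positivity
  by_cases hn : maxBlock η < n
  · -- `f ≡ 0` in dimension `n + bsum r k > 1/η`
    have : multiSlice r k ξ (fun β' => if ∀ t, η ≤ β' t then
        (∏ j, blockWeight γ (k j) (fun l =>
            β' (Fin.cast (bsum_eq_sum r k).symm (finSigmaFinEquiv (n := k) ⟨j, l⟩)))) *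
          f (n + bsum r k) (Fin.append β β') else 0) = 0 := by
      refine (multiSlice_congr r k ξ fun β' => ?_).trans (multiSlice_zero_fun r k ξ)
      rw [eq_zero_of_maxBlock_lt hη hsupp (by omega) (Fin.append β β')]
      simp
    rw [this, zero_div, abs_zero]
    positivity
  · push Not at hn
    have hprod : η ^ n ≤ ∏ t, β t := by
      calc η ^ n = ∏ _t : Fin n, η := by simp
        _ ≤ ∏ t, β t := Finset.prod_le_prod (fun t _ => hη.le) fun t _ => hβ t
    have hpos : 0 < ∏ t, β t := lt_of_lt_of_le (pow_pos hη n) hprod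
    have hpow : η ^ maxBlock η ≤ η ^ n := pow_le_pow_of_le_one hη.le hη1 hn
    rw [abs_div, abs_of_pos hpos, div_le_div_iff₀ hpos (pow_pos hη _)]
    exact mul_le_mul (abs_psiInner_le hη γ hFb k ξ n β) (hpow.trans hprod) (pow_nonneg hη.le _) hC0

/-! ### The iterated integrand over the `u`-blocks in terms of `Ψ` -/

/-- The iterated integrand over the `u`-blocks, after integrating out the `ξ`-blocks, is
`∏_j 𝓛_{1−γ}(β_j)/h_j! · Ψ(β)`. [cite: FordMaynard2024PrimeSieves, §6.1 (proof of Theorem 6.4)] -/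
theorem inner_eq_linnikProd_mul_psiFn (γ η : ℝ) (f : VecFn) {d r : ℕ} (h : Fin d → ℕ) (k : Fin r → ℕ)
    (ξ : Fin r → ℝ) (β : Fin (bsum d h) → ℝ) :
    multiSlice r k ξ (fun β' => if (∀ t, η ≤ β t) ∧ (∀ t, η ≤ β' t) then
        (∏ i, blockWeight γ (h i) (fun l =>
            β (Fin.cast (bsum_eq_sum d h).symm (finSigmaFinEquiv (n := h) ⟨i, l⟩)))) *
          (∏ j, blockWeight γ (k j) (fun l =>
            β' (Fin.cast (bsum_eq_sum r k).symm (finSigmaFinEquiv (n := k) ⟨j, l⟩)))) *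
          f (bsum d h + bsum r k) (Fin.append β β') else 0) =
      (∏ i, linnikFn (1 - γ) (fun l =>
          β (Fin.cast (bsum_eq_sum d h).symm (finSigmaFinEquiv (n := h) ⟨i, l⟩))) univ /
            ((h i).factorial : ℝ)) *
        (if ∀ t, η ≤ β t then
          multiSlice r k ξ (fun β' => if ∀ t, η ≤ β' t then
            (∏ j, blockWeight γ (k j) (fun l =>
                β' (Fin.cast (bsum_eq_sum r k).symm (finSigmaFinEquiv (n := k) ⟨j, l⟩)))) *
              f (bsum d h + bsum r k) (Fin.append β β') else 0) / ∏ t, β t else 0) := by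
  by_cases hβ : ∀ t, η ≤ β t
  · rw [if_pos hβ]
    have : (fun β' : Fin (bsum r k) → ℝ => if (∀ t, η ≤ β t) ∧ (∀ t, η ≤ β' t) then
        (∏ i, blockWeight γ (h i) (fun l =>
            β (Fin.cast (bsum_eq_sum d h).symm (finSigmaFinEquiv (n := h) ⟨i, l⟩)))) *
          (∏ j, blockWeight γ (k j) (fun l =>
            β' (Fin.cast (bsum_eq_sum r k).symm (finSigmaFinEquiv (n := k) ⟨j, l⟩)))) *
          f (bsum d h + bsum r k) (Fin.append β β') else 0) =
        fun β' => (∏ i, blockWeight γ (h i) (fun l =>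
            β (Fin.cast (bsum_eq_sum d h).symm (finSigmaFinEquiv (n := h) ⟨i, l⟩)))) *
          (if ∀ t, η ≤ β' t then
            (∏ j, blockWeight γ (k j) (fun l =>
                β' (Fin.cast (bsum_eq_sum r k).symm (finSigmaFinEquiv (n := k) ⟨j, l⟩)))) *
              f (bsum d h + bsum r k) (Fin.append β β') else 0) := by
      funext β'
      by_cases hβ' : ∀ t, η ≤ β' t
      · rw [if_pos ⟨hβ, hβ'⟩, if_pos hβ']; ring
      · rw [if_neg (fun h' => hβ' h'.2), if_neg hβ', mul_zero]
    rw [this, multiSlice_const_mul, prod_blockWeight_eq]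
    ring
  · rw [if_neg hβ, mul_zero]
    refine (multiSlice_congr r k ξ fun β' => ?_).trans (multiSlice_zero_fun r k ξ)
    rw [if_neg (fun h' => hβ h'.1)]

/-! ### The `d`-th term of (TypeI-f) in terms of `Ψ` -/

/-- **The `d`-th slice integral of (TypeI-f) through the fragmentation relation.** For `f`
symmetric, bounded, measurable, supported on vectors with entries `≥ η` summing to `1`, satisfying
`FragRel γ η f`, for `ξ ≥ η` and `d ≥ 1`:
`∫_{u ∈ Δ_d(1−|ξ|)} f(ξ,u)/∏u = ∏ξ · ∑_{h ∈ [1,N]^d} ∑_{k ∈ [1,N]^r} ∫_{Δ_{|h|}(1−|ξ|)} ∏_j 𝓛(β_j)/h_j! Ψ_k(β) dβ`.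
[cite: FordMaynard2024PrimeSieves, §6.1 (proof of Theorem 6.4, (6.3) ⇒ (TypeI-f))] -/
theorem sliceIntegral_typeI_eq (hη : 0 < η) (hη1 : η ≤ 1) (hs : f.IsSymmetric)
    (hfm : ∀ k, Measurable (f k)) {Fb : ℝ} (hFb : ∀ k ξ, |f k ξ| ≤ Fb)
    (hsupp : ∀ (k : ℕ) (ξ : Fin k → ℝ), f k ξ ≠ 0 → (∀ i, η ≤ ξ i) ∧ ∑ i, ξ i = 1)
    (hFR : FragRel γ η f) {r : ℕ} (ξ : Fin r → ℝ) (hξ : ∀ i, η ≤ ξ i) {d : ℕ} (hd : 1 ≤ d) :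
    sliceIntegral d (1 - ∑ i, ξ i) (fun u => f (r + d) (Fin.append ξ u) / ∏ i, u i) =
      (∏ j, ξ j) * ∑ h ∈ Fintype.piFinset (fun _ : Fin d => Finset.Icc 1 (maxBlock η)),
        ∑ k ∈ Fintype.piFinset (fun _ : Fin r => Finset.Icc 1 (maxBlock η)),
          sliceIntegral (bsum d h) (1 - ∑ i, ξ i) (fun β =>
            (∏ i, linnikFn (1 - γ) (fun l =>
                β (Fin.cast (bsum_eq_sum d h).symm (finSigmaFinEquiv (n := h) ⟨i, l⟩))) univ /
                  ((h i).factorial : ℝ)) *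
              (if ∀ t, η ≤ β t then
                multiSlice r k ξ (fun β' => if ∀ t, η ≤ β' t then
                  (∏ j, blockWeight γ (k j) (fun l =>
                      β' (Fin.cast (bsum_eq_sum r k).symm (finSigmaFinEquiv (n := k) ⟨j, l⟩)))) *
                    f (bsum d h + bsum r k) (Fin.append β β') else 0) / ∏ t, β t else 0)) := by
  have hFb0 : 0 ≤ Fb := (abs_nonneg _).trans (hFb 0 Fin.elim0)
  set w : ℝ := 1 - ∑ i, ξ i with hw
  set S : Finset ℕ := Finset.Icc 1 (maxBlock η) with hS
  -- the integrand of the `u`-blocks, for sizes `h` and `k`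
  set K : (h : Fin d → ℕ) → (k : Fin r → ℕ) → (Fin (bsum d h) → ℝ) → ℝ := fun h k β =>
    (∏ i, linnikFn (1 - γ) (fun l =>
        β (Fin.cast (bsum_eq_sum d h).symm (finSigmaFinEquiv (n := h) ⟨i, l⟩))) univ /
          ((h i).factorial : ℝ)) *
      (if ∀ t, η ≤ β t then
        multiSlice r k ξ (fun β' => if ∀ t, η ≤ β' t then
          (∏ j, blockWeight γ (k j) (fun l =>
              β' (Fin.cast (bsum_eq_sum r k).symm (finSigmaFinEquiv (n := k) ⟨j, l⟩)))) *
            f (bsum d h + bsum r k) (Fin.append β β') else 0) / ∏ t, β t else 0) with hK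
  have hKm : ∀ h k, Measurable (K h k) := fun h k =>
    (measurable_linnikProd (1 - γ) d h).mul (measurable_psiFn hfm γ η k ξ (bsum d h))
  set KC : (Fin d → ℕ) → (Fin r → ℕ) → ℝ := fun h k => (∏ i, ((h i : ℝ) * (2 ^ h i) ^ h i)) *
    ((∏ j, ((k j : ℝ) * (2 ^ k j) ^ k j / η ^ k j)) * Fb * (1 + ∑ j, |ξ j|) ^ bsum r k / η ^ maxBlock η)
    with hKC
  have hKC0 : ∀ h k, 0 ≤ KC h k := by
    intro h k
    have : 0 ≤ ∑ j, |ξ j| := Finset.sum_nonneg fun j _ => abs_nonneg _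
    refine mul_nonneg (Finset.prod_nonneg fun i _ => by positivity) ?_
    exact div_nonneg (mul_nonneg (mul_nonneg (Finset.prod_nonneg fun j _ => by positivity) hFb0)
      (by positivity)) (by positivity)
  have hKb : ∀ h k β, |K h k β| ≤ KC h k := by
    intro h k β
    simp only [hK, hKC]
    rw [abs_mul]
    exact mul_le_mul (abs_linnikProd_le (1 - γ) d h β) (abs_psiFn_le hη hη1 γ hFb hsupp k ξ _ β)
      (abs_nonneg _) (Finset.prod_nonneg fun i _ => by positivity)
  -- Step 1: the integrand on the slice
  have hpt : ∀ u : Fin d → ℝ, (∀ i, 0 < u i) → ∑ i, u i = w →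
      f (r + d) (Fin.append ξ u) / ∏ i, u i =
        (∏ j, ξ j) * ∑ h ∈ Fintype.piFinset (fun _ : Fin d => S),
          ∑ k ∈ Fintype.piFinset (fun _ : Fin r => S), multiSlice d h u (K h k) := by
    intro u hu husum
    have hprodu : 0 < ∏ i, u i := Finset.prod_pos fun i _ => hu i
    -- `f(ξ,u) = f(u,ξ) = fragOp f (u,ξ)`
    have h1 : f (r + d) (Fin.append ξ u) = fragOp γ η f (d + r) (Fin.append u ξ) := by
      rw [hs.append_swap ξ u]
      by_cases huη : ∀ i, η ≤ u i
      · refine hFR (d + r) (Fin.append u ξ) (fun i => ?_) ?_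
        · refine Fin.addCases (fun l => ?_) (fun l => ?_) i
          · rw [Fin.append_left]; exact huη l
          · rw [Fin.append_right]; exact hξ l
        · rw [Fin.sum_univ_add]
          simp only [Fin.append_left, Fin.append_right, husum, hw]
          ring
      · have hf0 : f (d + r) (Fin.append u ξ) = 0 := by
          by_contra hne
          exact huη fun i => by simpa using (hsupp _ _ hne).1 (Fin.castAdd r i)
        have hg0 : fragOp γ η f (d + r) (Fin.append u ξ) = 0 := by
          by_contra hne
          exact huη fun i => by simpa using (exists_isCoagulationOf_of_fragOp_ne_zero hne).1 (Fin.castAdd r i)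
        rw [hf0, hg0]
    rw [h1, fragOp_eq_multiSlice hη f hfm hFb (d + r) (Fin.append u ξ),
      Finset.sum_congr rfl fun kv _ => fragH_split γ η f kv u ξ,
      sum_piFinset_castAdd_natAdd S (fun h k => multiSlice d h u (fun β =>
        multiSlice r k ξ (fun β' => if (∀ t, η ≤ β t) ∧ (∀ t, η ≤ β' t) then
          (∏ i, blockWeight γ (h i) (fun l =>
              β (Fin.cast (bsum_eq_sum d h).symm (finSigmaFinEquiv (n := h) ⟨i, l⟩)))) *
            (∏ j, blockWeight γ (k j) (fun l =>
              β' (Fin.cast (bsum_eq_sum r k).symm (finSigmaFinEquiv (n := k) ⟨j, l⟩)))) *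
            f (bsum d h + bsum r k) (Fin.append β β') else 0)))]
    simp only [inner_eq_linnikProd_mul_psiFn]
    rw [Fin.prod_univ_add]
    simp only [Fin.append_left, Fin.append_right, hK]
    have hne : (∏ i, u i) ≠ 0 := hprodu.ne'
    rw [div_eq_iff hne]
    ring
  rw [sliceIntegral_congr hpt, sliceIntegral_const_mul]
  congr 1
  -- Step 2: finite additivity (with the integrands truncated to `u ≤ w`, where they are bounded)
  have htrunc : ∀ h k, sliceIntegral d w (fun u => multiSlice d h u (K h k)) =
      sliceIntegral d w (fun u => if ∀ i, u i ≤ w then multiSlice d h u (K h k) else 0) := by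
    intro h k
    refine sliceIntegral_congr fun u hu husum => ?_
    rw [if_pos]
    intro i
    rw [← husum]
    exact Finset.single_le_sum (fun j _ => (hu j).le) (Finset.mem_univ i)
  have hmeas : ∀ h k, Measurable fun u : Fin d → ℝ => if ∀ i, u i ≤ w then multiSlice d h u (K h k) else 0 := by
    intro h k
    refine Measurable.ite ?_ ?_ measurable_const
    · exact (Measurable.forall fun i => measurableSet_setOf.1
        (measurableSet_le (measurable_pi_apply i) measurable_const)).setOf
    · exact measurable_multiSlice_param (X := Fin d → ℝ) d h measurable_id ((hKm h k).comp measurable_snd)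
  have hbd : ∀ h k (u : Fin d → ℝ), |(if ∀ i, u i ≤ w then multiSlice d h u (K h k) else 0)| ≤
      KC h k * max w 1 ^ bsum d h := by
    intro h k u
    split_ifs with hu
    · exact abs_multiSlice_le d h (le_max_right _ _) (fun i => (hu i).trans (le_max_left _ _)) (hKC0 h k)
        (hKb h k)
    · rw [abs_zero]; exact mul_nonneg (hKC0 h k) (by positivity)
  have hlin : sliceIntegral d w (fun u => ∑ h ∈ Fintype.piFinset (fun _ : Fin d => S),
      ∑ k ∈ Fintype.piFinset (fun _ : Fin r => S), multiSlice d h u (K h k)) =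
      ∑ h ∈ Fintype.piFinset (fun _ : Fin d => S), ∑ k ∈ Fintype.piFinset (fun _ : Fin r => S),
        sliceIntegral d w (fun u => multiSlice d h u (K h k)) := by
    have htr : sliceIntegral d w (fun u => ∑ h ∈ Fintype.piFinset (fun _ : Fin d => S),
        ∑ k ∈ Fintype.piFinset (fun _ : Fin r => S), multiSlice d h u (K h k)) =
        sliceIntegral d w (fun u => ∑ h ∈ Fintype.piFinset (fun _ : Fin d => S),
          ∑ k ∈ Fintype.piFinset (fun _ : Fin r => S),
            if ∀ i, u i ≤ w then multiSlice d h u (K h k) else 0) := by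
      refine sliceIntegral_congr fun u hu husum => ?_
      have : ∀ i, u i ≤ w := fun i => by
        rw [← husum]; exact Finset.single_le_sum (fun j _ => (hu j).le) (Finset.mem_univ i)
      simp only [this, implies_true, if_true]
    rw [htr, sliceIntegral_finset_sum' _ d w _ (fun h _ => Finset.measurable_sum _ fun k _ => hmeas h k)
      (C := ∑ h ∈ Fintype.piFinset (fun _ : Fin d => S), ∑ k ∈ Fintype.piFinset (fun _ : Fin r => S),
        KC h k * max w 1 ^ bsum d h) ?_]
    · refine Finset.sum_congr rfl fun h hh => ?_
      rw [sliceIntegral_finset_sum' _ d w _ (fun k _ => hmeas h k)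
        (C := ∑ k ∈ Fintype.piFinset (fun _ : Fin r => S), KC h k * max w 1 ^ bsum d h) ?_]
      · exact Finset.sum_congr rfl fun k _ => (htrunc h k).symm
      · intro k hk u
        exact (hbd h k u).trans (Finset.single_le_sum (f := fun k => KC h k * max w 1 ^ bsum d h)
          (fun k _ => mul_nonneg (hKC0 h k) (by positivity)) hk)
    · intro h hh u
      refine (Finset.abs_sum_le_sum_abs _ _).trans ((Finset.sum_le_sum fun k _ => hbd h k u).trans ?_)
      exact Finset.single_le_sum (f := fun h => ∑ k ∈ Fintype.piFinset (fun _ : Fin r => S),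
        KC h k * max w 1 ^ bsum d h) (fun h _ => Finset.sum_nonneg fun k _ =>
          mul_nonneg (hKC0 h k) (by positivity)) hh
  rw [hlin]
  -- Step 3: the multi-block Fubini formula
  refine Finset.sum_congr rfl fun h hh => Finset.sum_congr rfl fun k _ => ?_
  have hh1 : ∀ j, 1 ≤ h j := fun j => (Finset.mem_Icc.1 (Fintype.mem_piFinset.1 hh j)).1
  exact sliceIntegral_multiSlice hd h hh1 w (K h k) (hKm h k) (hKC0 h k) (hKb h k)

/-! ### Summing over `d`: Lemma 5.4 -/

/-- **The partial sums of (TypeI-f) vanish under the fragmentation relation.** With the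
hypotheses of `sliceIntegral_typeI_eq`, `|ξ| ≤ γ < 1` and `M ≥ ⌊1/η⌋`:
`∑_{d=1}^{M} (1/d!) ∫_{Δ_d(1−|ξ|)} f(ξ,u)/∏u = 0`.
[cite: FordMaynard2024PrimeSieves, §6.1 (proof of Theorem 6.4, (6.3) ⇒ (TypeI-f)) and Lemma 5.4] -/
theorem sum_typeITerm_eq_zero_of_fragRel (hη : 0 < η) (hη1 : η ≤ 1) (hγ1 : γ < 1) (hs : f.IsSymmetric)
    (hfm : ∀ k, Measurable (f k)) {Fb : ℝ} (hFb : ∀ k ξ, |f k ξ| ≤ Fb)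
    (hsupp : ∀ (k : ℕ) (ξ : Fin k → ℝ), f k ξ ≠ 0 → (∀ i, η ≤ ξ i) ∧ ∑ i, ξ i = 1)
    (hFR : FragRel γ η f) {r : ℕ} (ξ : Fin r → ℝ) (hξ : ∀ i, η ≤ ξ i) (hξγ : ∑ i, ξ i ≤ γ)
    {M : ℕ} (hM : maxBlock η ≤ M) :
    ∑ d ∈ Finset.Icc 1 M, typeITerm f r ξ d = 0 := by
  have hFb0 : 0 ≤ Fb := (abs_nonneg _).trans (hFb 0 Fin.elim0)
  set N : ℕ := maxBlock η with hN
  set S : Finset ℕ := Finset.Icc 1 (maxBlock η) with hS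
  set w : ℝ := 1 - ∑ i, ξ i with hw
  have hwc : 1 - γ ≤ w := by rw [hw]; linarith
  have hc : 0 < 1 - γ := by linarith
  -- the functions `Ψ_k` as functions on variable-length vectors
  set Ψ : (Fin r → ℕ) → VecFn := fun k n β => if ∀ t, η ≤ β t then
    multiSlice r k ξ (fun β' => if ∀ t, η ≤ β' t then
      (∏ j, blockWeight γ (k j) (fun l =>
          β' (Fin.cast (bsum_eq_sum r k).symm (finSigmaFinEquiv (n := k) ⟨j, l⟩)))) *
        f (n + bsum r k) (Fin.append β β') else 0) / ∏ t, β t else 0 with hΨ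
  have hΨs : ∀ k, (Ψ k).IsSymmetric := fun k => psiFn_symm hs γ η k ξ
  have hΨm : ∀ k n, Measurable (Ψ k n) := fun k n => measurable_psiFn hfm γ η k ξ n
  set BΨ : (Fin r → ℕ) → ℝ := fun k => (∏ j, ((k j : ℝ) * (2 ^ k j) ^ k j / η ^ k j)) * Fb *
    (1 + ∑ j, |ξ j|) ^ bsum r k / η ^ maxBlock η with hBΨ
  have hΨb : ∀ k n β, |Ψ k n β| ≤ BΨ k := fun k n β => abs_psiFn_le hη hη1 γ hFb hsupp k ξ n β
  -- Step 1: every term through `Ψ`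
  have hterm : ∀ d ∈ Finset.Icc 1 M, typeITerm f r ξ d = (1 / (d.factorial : ℝ)) * ((∏ j, ξ j) *
      ∑ h ∈ Fintype.piFinset (fun _ : Fin d => S), ∑ k ∈ Fintype.piFinset (fun _ : Fin r => S),
        sliceIntegral (bsum d h) w (fun β =>
          (∏ i, linnikFn (1 - γ) (fun l =>
              β (Fin.cast (bsum_eq_sum d h).symm (finSigmaFinEquiv (n := h) ⟨i, l⟩))) univ /
                ((h i).factorial : ℝ)) * Ψ k (bsum d h) β)) := by
    intro d hd
    unfold typeITerm
    rw [sliceIntegral_typeI_eq hη hη1 hs hfm hFb hsupp hFR ξ hξ (Finset.mem_Icc.1 hd).1]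
  rw [Finset.sum_congr rfl hterm]
  -- Step 2: reorganise: for every `k` and every `d`, group the sizes `h` by their total `a`
  have hfib : ∀ d ∈ Finset.Icc 1 M, ∀ k,
      ∑ h ∈ Fintype.piFinset (fun _ : Fin d => S), sliceIntegral (bsum d h) w (fun β =>
          (∏ i, linnikFn (1 - γ) (fun l =>
              β (Fin.cast (bsum_eq_sum d h).symm (finSigmaFinEquiv (n := h) ⟨i, l⟩))) univ /
                ((h i).factorial : ℝ)) * Ψ k (bsum d h) β) =
        ∑ a ∈ Finset.range (N + 1), (1 / (a.factorial : ℝ)) *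
          sliceIntegral a w (fun v => spow (linnikFn (1 - γ) v) d univ * Ψ k a v) := by
    intro d hd k
    have hd1 : 1 ≤ d := (Finset.mem_Icc.1 hd).1
    rw [← Finset.sum_fiberwise_of_maps_to (t := Finset.range (M * N + 1)) (g := fun h => bsum d h)
      (fun h hh => ?_)]
    swap
    · -- `bsum d h ≤ d N ≤ M N`
      rw [Finset.mem_range, Nat.lt_succ_iff, bsum_eq_sum]
      calc ∑ j, h j ≤ ∑ _j : Fin d, N :=
            Finset.sum_le_sum fun j _ => (Finset.mem_Icc.1 (Fintype.mem_piFinset.1 hh j)).2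
        _ = d * N := by simp
        _ ≤ M * N := Nat.mul_le_mul_right _ (Finset.mem_Icc.1 hd).2
    -- the fibres with `a ≤ N` are given by `claim`, the others vanish
    have hsubset : Finset.range (N + 1) ⊆ Finset.range (M * N + 1) := by
      refine Finset.range_subset_range.2 ?_
      have hM1 : 1 ≤ M := (Finset.mem_Icc.1 hd).1.trans (Finset.mem_Icc.1 hd).2
      have : N ≤ M * N := Nat.le_mul_of_pos_left N hM1
      omega
    symm
    refine (Finset.sum_subset hsubset fun a ha ha' => ?_).trans (Finset.sum_congr rfl fun a _ => ?_)
    · -- here we must show the `claim`-side term vanishes for `N < a ≤ M N`; instead we show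
      -- that both regroupings agree fibrewise, see the next goal; this goal: the extra terms
      -- of the left-hand side vanish
      simp only [Finset.mem_range, not_lt] at ha ha'
      have : sliceIntegral a w (fun v => spow (linnikFn (1 - γ) v) d univ * Ψ k a v) =
          sliceIntegral a w (fun _ => 0) := by
        refine sliceIntegral_congr fun v hv hvsum => ?_
        have hΨ0 : Ψ k a v = 0 := by
          simp only [hΨ]
          rw [if_neg]
          intro hvη
          have hle : (a : ℝ) * η ≤ 1 := by
            calc (a : ℝ) * η = ∑ _t : Fin a, η := by simp
              _ ≤ ∑ t, v t := Finset.sum_le_sum fun t _ => hvη t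
              _ = w := hvsum
              _ ≤ 1 := by
                rw [hw]
                have : 0 ≤ ∑ i, ξ i := Finset.sum_nonneg fun i _ => (hη.le.trans (hξ i))
                linarith
          have : (a : ℝ) ≤ 1 / η := by rw [le_div_iff₀ hη]; exact hle
          have : a ≤ N := Nat.le_floor this
          omega
        rw [hΨ0, mul_zero]
      rw [this, sliceIntegral_zero, mul_zero]
    · by_cases haN : a ≤ N
      · exact (claim (1 - γ) N d hd1 (Ψ k) (hΨs k) (hΨm k) (BΨ k) (hΨb k) w a haN).symm
      · -- `a > N`: both sides vanish
        push Not at haN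
        have hzero : ∀ h ∈ (Fintype.piFinset fun _ : Fin d => S).filter (fun h => bsum d h = a),
            sliceIntegral (bsum d h) w (fun β =>
              (∏ i, linnikFn (1 - γ) (fun l =>
                  β (Fin.cast (bsum_eq_sum d h).symm (finSigmaFinEquiv (n := h) ⟨i, l⟩))) univ /
                    ((h i).factorial : ℝ)) * Ψ k (bsum d h) β) = 0 := by
          intro h hh
          have hba : bsum d h = a := (Finset.mem_filter.1 hh).2
          rw [← sliceIntegral_zero (bsum d h) w]
          refine sliceIntegral_congr fun β hβ hβsum => ?_
          have hΨ0 : Ψ k (bsum d h) β = 0 := by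
            simp only [hΨ]
            rw [if_neg]
            intro hβη
            have hle : (bsum d h : ℝ) * η ≤ 1 := by
              calc (bsum d h : ℝ) * η = ∑ _t : Fin (bsum d h), η := by simp
                _ ≤ ∑ t, β t := Finset.sum_le_sum fun t _ => hβη t
                _ = w := hβsum
                _ ≤ 1 := by
                  rw [hw]
                  have : 0 ≤ ∑ i, ξ i := Finset.sum_nonneg fun i _ => (hη.le.trans (hξ i))
                  linarith
            have : (bsum d h : ℝ) ≤ 1 / η := by rw [le_div_iff₀ hη]; exact hle
            have : bsum d h ≤ N := Nat.le_floor this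
            omega
          rw [hΨ0, mul_zero]
        have hright : sliceIntegral a w (fun v => spow (linnikFn (1 - γ) v) d univ * Ψ k a v) =
            sliceIntegral a w (fun _ => 0) := by
          refine sliceIntegral_congr fun v hv hvsum => ?_
          have hΨ0 : Ψ k a v = 0 := by
            simp only [hΨ]
            rw [if_neg]
            intro hvη
            have hle : (a : ℝ) * η ≤ 1 := by
              calc (a : ℝ) * η = ∑ _t : Fin a, η := by simp
                _ ≤ ∑ t, v t := Finset.sum_le_sum fun t _ => hvη t
                _ = w := hvsum
                _ ≤ 1 := by
                  rw [hw]
                  have : 0 ≤ ∑ i, ξ i := Finset.sum_nonneg fun i _ => (hη.le.trans (hξ i))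
                  linarith
            have : (a : ℝ) ≤ 1 / η := by rw [le_div_iff₀ hη]; exact hle
            have : a ≤ N := Nat.le_floor this
            omega
          rw [hΨ0, mul_zero]
        rw [Finset.sum_eq_zero hzero, hright, sliceIntegral_zero, mul_zero]
  -- Step 3: sum over `d` first: Lemma 5.4
  have hreorg : ∑ d ∈ Finset.Icc 1 M, (1 / (d.factorial : ℝ)) * ((∏ j, ξ j) *
      ∑ h ∈ Fintype.piFinset (fun _ : Fin d => S), ∑ k ∈ Fintype.piFinset (fun _ : Fin r => S),
        sliceIntegral (bsum d h) w (fun β =>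
          (∏ i, linnikFn (1 - γ) (fun l =>
              β (Fin.cast (bsum_eq_sum d h).symm (finSigmaFinEquiv (n := h) ⟨i, l⟩))) univ /
                ((h i).factorial : ℝ)) * Ψ k (bsum d h) β)) =
      (∏ j, ξ j) * ∑ k ∈ Fintype.piFinset (fun _ : Fin r => S), ∑ a ∈ Finset.range (N + 1),
        (1 / (a.factorial : ℝ)) * ∑ d ∈ Finset.Icc 1 M, (1 / (d.factorial : ℝ)) *
          sliceIntegral a w (fun v => spow (linnikFn (1 - γ) v) d univ * Ψ k a v) := by
    have h1 : ∀ d ∈ Finset.Icc 1 M, (1 / (d.factorial : ℝ)) * ((∏ j, ξ j) *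
        ∑ h ∈ Fintype.piFinset (fun _ : Fin d => S), ∑ k ∈ Fintype.piFinset (fun _ : Fin r => S),
          sliceIntegral (bsum d h) w (fun β =>
            (∏ i, linnikFn (1 - γ) (fun l =>
                β (Fin.cast (bsum_eq_sum d h).symm (finSigmaFinEquiv (n := h) ⟨i, l⟩))) univ /
                  ((h i).factorial : ℝ)) * Ψ k (bsum d h) β)) =
        (∏ j, ξ j) * ∑ k ∈ Fintype.piFinset (fun _ : Fin r => S), ∑ a ∈ Finset.range (N + 1),
          (1 / (a.factorial : ℝ)) * ((1 / (d.factorial : ℝ)) *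
            sliceIntegral a w (fun v => spow (linnikFn (1 - γ) v) d univ * Ψ k a v)) := by
      intro d hd
      rw [Finset.sum_comm, Finset.sum_congr rfl fun k _ => hfib d hd k]
      simp only [Finset.mul_sum]
      exact Finset.sum_congr rfl fun k _ => Finset.sum_congr rfl fun a _ => by ring
    rw [Finset.sum_congr rfl h1, ← Finset.mul_sum, Finset.sum_comm]
    congr 1
    refine Finset.sum_congr rfl fun k _ => ?_
    rw [Finset.sum_comm]
    refine Finset.sum_congr rfl fun a _ => ?_
    rw [Finset.mul_sum]
  rw [hreorg]
  refine mul_eq_zero_of_right _ (Finset.sum_eq_zero fun k _ => Finset.sum_eq_zero fun a ha => ?_)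
  have haN : a ≤ N := Nat.lt_succ_iff.1 (Finset.mem_range.1 ha)
  refine mul_eq_zero_of_right _ ?_
  -- the sum over `d` inside the slice integral, and Lemma 5.4
  have hmeas : ∀ d ∈ Finset.Icc 1 M, Measurable fun v : Fin a → ℝ =>
      (1 / (d.factorial : ℝ)) * (spow (linnikFn (1 - γ) v) d univ * Ψ k a v) := fun d _ =>
    ((measurable_spow_linnikFn (1 - γ) d univ).mul (hΨm k a)).const_mul _
  have hbd : ∀ d ∈ Finset.Icc 1 M, ∀ v : Fin a → ℝ,
      |(1 / (d.factorial : ℝ)) * (spow (linnikFn (1 - γ) v) d univ * Ψ k a v)| ≤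
        (2 ^ a * (a * (2 ^ a) ^ a) + 1) ^ M * |BΨ k| := by
    intro d hd v
    have hdM : d ≤ M := (Finset.mem_Icc.1 hd).2
    have hfac : (1 : ℝ) ≤ d.factorial := by exact_mod_cast Nat.one_le_iff_ne_zero.2 (Nat.factorial_ne_zero d)
    rw [abs_mul, abs_mul, abs_div, abs_one, Nat.abs_cast]
    have hb0 : (0 : ℝ) ≤ 2 ^ a * (a * (2 ^ a) ^ a) := by positivity
    have hb1 : (1 : ℝ) ≤ 2 ^ a * (a * (2 ^ a) ^ a) + 1 := by linarith
    have h2 : |spow (linnikFn (1 - γ) v) d univ| ≤ (2 ^ a * (a * (2 ^ a) ^ a) + 1) ^ M :=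
      (abs_spow_linnikFn_le (1 - γ) v d univ).trans
        ((pow_le_pow_left₀ hb0 (by linarith) d).trans (pow_le_pow_right₀ hb1 hdM))
    calc 1 / (d.factorial : ℝ) * (|spow (linnikFn (1 - γ) v) d univ| * |Ψ k a v|)
        ≤ 1 * ((2 ^ a * (a * (2 ^ a) ^ a) + 1) ^ M * |BΨ k|) :=
          mul_le_mul (div_le_one_of_le₀ hfac (by positivity))
            (mul_le_mul h2 ((hΨb k a v).trans (le_abs_self _)) (abs_nonneg _) (by positivity))
            (by positivity) zero_le_one
      _ = _ := one_mul _
  rw [Finset.sum_congr rfl fun d (_ : d ∈ Finset.Icc 1 M) => by rw [← sliceIntegral_const_mul],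
    ← sliceIntegral_finset_sum' _ a w _ hmeas hbd, ← sliceIntegral_zero a w]
  refine sliceIntegral_congr fun v hv hvsum => ?_
  have hkey := FordMaynard_lemma_5_4 (α := Fin a) hc v 1 (R := M)
    (by rw [Fintype.card_fin]; exact haN.trans hM) (by rw [hvsum]; simpa using hwc)
  simp only [Nat.cast_one, one_pow] at hkey
  calc ∑ d ∈ Finset.Icc 1 M, 1 / (d.factorial : ℝ) * (spow (linnikFn (1 - γ) v) d univ * Ψ k a v)
      = (∑ d ∈ Finset.Icc 1 M, 1 / (d.factorial : ℝ) * spow (linnikFn (1 - γ) v) d univ) * Ψ k a v := by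
        rw [Finset.sum_mul]
        exact Finset.sum_congr rfl fun d _ => by ring
    _ = 0 := by rw [hkey, zero_mul]

/-! ### The fragmentation relation implies (TypeI-f) -/

/-- **Theorem 6.4, converse direction: (6.3) ⇒ (TypeI-f).** Let `0 < η`, `γ < 1`, and let
`f ∈ 𝒮` be bounded, measurable in each dimension, supported on the vectors with all entries
`≥ η` summing to `1`, and satisfy the fragmentation relation `FragRel γ η f`. Then `f` satisfies
(TypeI-f) with parameter `γ`. [cite: FordMaynard2024PrimeSieves, Theorem 6.4] -/
theorem typeI_of_fragRel (hη : 0 < η) (hγ1 : γ < 1) (hs : f.IsSymmetric)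
    (hfm : ∀ k, Measurable (f k)) {Fb : ℝ} (hFb : ∀ k ξ, |f k ξ| ≤ Fb)
    (hsupp : ∀ (k : ℕ) (ξ : Fin k → ℝ), f k ξ ≠ 0 → (∀ i, η ≤ ξ i) ∧ ∑ i, ξ i = 1)
    (hFR : FragRel γ η f) : TypeIIdentity γ f := by
  intro r ξ hξγ
  refine ⟨maxBlock η, fun M hM => ?_⟩
  -- if some `ξ_i < η`, or if `η > 1`, every term vanishes since `f(ξ, ·) ≡ 0`
  by_cases htriv : (∃ i, ξ i < η) ∨ 1 < η
  · refine Finset.sum_eq_zero fun d hd => ?_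
    have hd1 : 1 ≤ d := (Finset.mem_Icc.1 hd).1
    unfold typeITerm
    have : (fun u : Fin d → ℝ => f (r + d) (Fin.append ξ u) / ∏ i, u i) = fun _ => 0 := by
      funext u
      have hz : f (r + d) (Fin.append ξ u) = 0 := by
        by_contra h
        obtain ⟨hge, hsum⟩ := hsupp _ _ h
        rcases htriv with ⟨i, hi⟩ | hη1
        · have := hge (Fin.castAdd d i)
          rw [Fin.append_left] at this
          linarith
        · have hle : ((r + d : ℕ) : ℝ) * η ≤ 1 := by
            calc ((r + d : ℕ) : ℝ) * η = ∑ _i : Fin (r + d), η := by simp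
              _ ≤ ∑ i, Fin.append ξ u i := Finset.sum_le_sum fun i _ => hge i
              _ = 1 := hsum
          have h1 : (1 : ℝ) ≤ (r + d : ℕ) := by exact_mod_cast (show 1 ≤ r + d by omega)
          nlinarith
      rw [hz, zero_div]
    rw [this, sliceIntegral_zero, mul_zero]
  push Not at htriv
  obtain ⟨hξ, hη1⟩ := htriv
  exact sum_typeITerm_eq_zero_of_fragRel hη hη1 hγ1 hs hfm hFb hsupp hFR ξ (fun i => hξ i) hξγ hM

end Backward

end Literature.NumberTheory.Sieve.FordMaynard
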